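import Literature.RingTheory.GaloisAlgebras.ChaseHarrisonRosenberg
import Mathlib.RingTheory.IsTensorProduct
import Mathlib.RingTheory.Finiteness.Nakayama
import HarnessLib

/-!
# Galois descent of modules along a free finite group action (Greither, Ch. 0, Thm. 7.1 / Prop. 7.2)

Let a finite group `G` act on the commutative `A`-algebra `B` by `A`-algebra automorphisms
(`MulSemiringAction G B`, `SMulCommClass G A B`) with ring of invariants `B^G = A ⊆ B`
(`Algebra.IsInvariant A B G`, `FaithfulSMul A B`), and suppose the action is **free**: for every
`g ≠ 1` the elements `g • b - b` generate the unit ideal (the hypothesis `hfree` of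
`Literature.RingTheory.GaloisAlgebras.ChaseHarrisonRosenberg`, which makes `B ⊇ A` a `G`-Galois
extension: dual family (ii′) `exists_finset_sum_mul_smul_of_free`, `B` finite projective over `A`,
`B ⊗_A B ≅ ∏_G B`).

A **descent datum** on a `B`-module `M` (Greither, Ch. 0 §7, Definition (b)) is a `G`-action on
`M` by `σ`-semilinear automorphisms with `Φ_σ Φ_τ = Φ_{στ}` — in Mathlib's vocabulary a
`DistribMulAction G M` with `SMulDistribClass G B M` (`g • (b • m) = (g • b) • (g • m)`).
Write `M^G = {m | ∀ g, g • m = m}`; it is an `A`-submodule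
(`exists_submodule_mem_iff_forall_smul_eq`), and throughout we work with any `A`-submodule `N`
*characterised* by `hN : ∀ m, m ∈ N ↔ ∀ g, g • m = m` (no new definition is introduced).

## Main statements

* `sum_smul_sum_smul_smul_eq_self` — the **descent formula** `m = ∑ₚ xₚ • ∑_g g • (yₚ • m)` for a
  dual family `(xₚ, yₚ)ₚ` (each inner sum lies in `M^G`).
* `isBaseChange_of_free` — **Theorem 7.1 (Galois descent of modules)**: the inclusion
  `N = M^G ↪ M` is a base change along `A → B`, i.e. the canonical map `B ⊗_A M^G → M`,
  `b ⊗ n ↦ b • n`, is an isomorphism (Mathlib `IsBaseChange B N.subtype`); the explicit inverse is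
  `m ↦ ∑ₚ xₚ ⊗ tr_M(yₚ • m)` with `tr_M = ∑_g g •`, the dual-basis proof of
  Chase–Harrison–Rosenberg, Thm. 1.3 (Greither proves 7.1 by faithfully flat base change to the
  trivial extension instead).
* `exists_trace_eq_one_of_free`, `exists_linearMap_apply_coe_eq_self_of_free`,
  `finite_invariants_of_free` — the trace `B → A` takes the value `1` (Nakayama), hence
  `m ↦ ∑_g g • (c • m)` (`tr c = 1`) is an `A`-linear retraction `M → M^G`, and `M^G` is a finitely
  generated `A`-module when `M` is a finitely generated `B`-module.
* `map_mem_of_forall_map_smul`, `eq_of_forall_apply_coe_eq_of_free`, `existsUnique_extend_of_free`,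
  `map_smul_of_forall_apply_coe_mem_of_free` — **Proposition 7.2 (descent of morphisms)**:
  `G`-equivariant `B`-linear maps send `M^G` to `M′^G`, are determined by their restriction to
  `M^G`, every `A`-linear `M^G → M′^G` extends uniquely to a `B`-linear `M → M′`, and a `B`-linear
  map restricting to `M^G → M′^G` is `G`-equivariant.

Geometric meaning ([MFK94] Prop. 7.1, the affine step; Mumford, *Abelian Varieties* §7 Thm. 4 and
§12 Thm. 1): for a free quotient `π : X = Spec B → Y = Spec A = X/G` by a finite group,
quasi-coherent `G`-sheaves on `X` are exactly the pull-backs `π^* 𝒢` of quasi-coherent sheaves on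
`Y`, with `𝒢 = (π_* ℱ)^G`. The Zariski gluing of this affine statement over the Galois charts of
`Literature.AlgebraicGeometry.Modules.PullbackPushforwardGaloisChart` is NOT in this file.

## What is used / what is not restated

The dual family and the identity `sum_sum_smul_mul_eq_self`, the trace `trace`/`algebraMap_trace`
/`trace_smul` and `finite_of_free` come from `ChaseHarrisonRosenberg`; the decomposition direction
(`T ⊗_R N ≅ ∏_G T ⊗_{S,σ} M` for an already descended `N`) is `ChaseHarrisonRosenbergModules`
(`galoisProd_bijective`), and the field/algebra special case is
`GaloisDescentAlgebras.mulInvariants_bijective` — none of them is restated here.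

## References

* [Greither1992CyclicGalois] C. Greither, *Cyclic Galois Extensions of Commutative Rings*, LNM 1534
  (1992), Ch. 0 §7 "Galois descent", Theorem 7.1 and Proposition 7.2 (pp. 28–29); Ch. 0 Thm. 1.6
  for the dual family (held: galaxy panama:519141287002184, §7 read 2026-08-28).
* [ChaseHarrisonRosenberg1965] S. U. Chase, D. K. Harrison, A. Rosenberg, *Galois theory and Galois
  cohomology of commutative rings*, Mem. AMS 52 (1965), Thm. 1.3 and Lemma 1.6 (trace onto).
-/

noncomputable section

open scoped TensorProduct

namespace Literature.RingTheory.GaloisAlgebras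

/-! ### The descent datum: compatibility with `A` and the invariant submodule -/

/-- A descent datum fixes the image of `A` pointwise on `M`: `g • (a • m) = a • (g • m)`, since
`a • m = algebraMap a • m` and `g • algebraMap a = algebraMap a`. In Greither, Ch. 0 §7,
Definition (b), the `Φ_σ` of a descent datum are *assumed* `R`-linear ("a family of
`R`-automorphisms `Φ_σ` … `σ`-linear"); in the Mathlib spelling (`SMulDistribClass G B M` over an
action by `A`-algebra automorphisms) this is automatic.
[cite: Greither1992CyclicGalois, Ch. 0 §7 Definition (b) (p. 28)] -/
theorem smul_algebraMap_smul_comm {A : Type*} (B : Type*) [CommRing A] [CommRing B] [Algebra A B]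
    {G : Type*} [Group G] [MulSemiringAction G B] [SMulCommClass G A B]
    {M : Type*} [AddCommGroup M] [Module B M] [Module A M] [IsScalarTower A B M]
    [DistribMulAction G M] [SMulDistribClass G B M] (g : G) (a : A) (m : M) :
    g • (a • m) = a • (g • m) := by
  have h : g • algebraMap A B a = algebraMap A B a := smul_algebraMap g a
  rw [← algebraMap_smul B a m, smul_distrib_smul, h, algebraMap_smul]

variable (A : Type*) {B : Type*} [CommRing A] [CommRing B] [Algebra A B]
variable (G : Type*) [Group G] [MulSemiringAction G B]
variable {M : Type*} [AddCommGroup M] [Module B M] [DistribMulAction G M]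

section Compat

variable [SMulCommClass G A B] [Module A M] [IsScalarTower A B M] [SMulDistribClass G B M]

include B in
/-- **The invariant submodule exists**: `M^G = {m | ∀ g, g • m = m}` is an `A`-submodule of `M`
(Greither, Ch. 0, Thm. 7.1: "`A = B^Φ` is an `R`-object"). All results below are stated for any
submodule `N` characterised by membership `m ∈ N ↔ ∀ g, g • m = m`.
[cite: Greither1992CyclicGalois, Ch. 0 Thm. 7.1 (p. 28)] -/
theorem exists_submodule_mem_iff_forall_smul_eq :
    ∃ N : Submodule A M, ∀ m : M, m ∈ N ↔ ∀ g : G, g • m = m := by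
  refine ⟨{ carrier := {m | ∀ g : G, g • m = m}
            add_mem' := fun {x y} hx hy g ↦ by rw [smul_add, hx g, hy g]
            zero_mem' := fun g ↦ smul_zero g
            smul_mem' := fun a x hx g ↦ by
              rw [Set.mem_setOf_eq] at hx
              rw [smul_algebraMap_smul_comm B g a x, hx g] }, fun m ↦ Iff.rfl⟩

variable [Fintype G]

/-- **The module trace into the invariants.** For `y ∈ B` the map `m ↦ ∑_g g • (y • m)` is
`A`-linear with values in `M^G` (its value is `G`-invariant by reindexing the sum); these are the
coefficient maps of the inverse of `B ⊗_A M^G → M`. [folklore] -/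
private theorem exists_linearMap_coe_apply_eq (N : Submodule A M)
    (hN : ∀ m : M, m ∈ N ↔ ∀ g : G, g • m = m) (y : B) :
    ∃ τ : M →ₗ[A] N, ∀ m : M, (τ m : M) = ∑ g : G, g • (y • m) := by
  have hinv : ∀ (m : M) (h : G), h • ∑ g : G, g • (y • m) = ∑ g : G, g • (y • m) := by
    intro m h
    rw [Finset.smul_sum]
    simp_rw [smul_smul]
    exact Fintype.sum_equiv (Equiv.mulLeft h) _ _ fun _ ↦ rfl
  refine ⟨{ toFun := fun m ↦ ⟨∑ g : G, g • (y • m), (hN _).mpr (hinv m)⟩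
            map_add' := fun m m' ↦ Subtype.ext <| by
              change ∑ g : G, g • (y • (m + m')) =
                (∑ g : G, g • (y • m)) + ∑ g : G, g • (y • m')
              simp_rw [smul_add, Finset.sum_add_distrib]
            map_smul' := fun a m ↦ Subtype.ext <| by
              change ∑ g : G, g • (y • (a • m)) = a • ∑ g : G, g • (y • m)
              rw [Finset.smul_sum]
              exact Finset.sum_congr rfl fun g _ ↦ by
                rw [smul_comm y a m, smul_algebraMap_smul_comm B g a (y • m)] }, fun m ↦ rfl⟩

end Compat

/-! ### The descent formula (surjectivity of `B ⊗_A M^G → M`) -/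

section Formula

variable {G}
variable [SMulDistribClass G B M] [Fintype G]

/-- On an invariant element `n` the module trace is multiplication by the ring trace:
`∑_g g • (b • n) = (∑_g g • b) • n`. [folklore] -/
private theorem sum_smul_smul_eq_sum_smul_smul (b : B) {n : M} (hn : ∀ g : G, g • n = n) :
    ∑ g : G, g • (b • n) = (∑ g : G, g • b) • n := by
  rw [Finset.sum_smul]
  exact Finset.sum_congr rfl fun g _ ↦ by rw [smul_distrib_smul, hn g]

variable {s : Finset (B × B)}

/-- **Descent formula.** For a dual family `(xₚ, yₚ)ₚ` (`∑ₚ xₚ yₚ = 1`, `∑ₚ xₚ · g(yₚ) = 0` for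
`g ≠ 1`) and a descent datum on `M`, every `m ∈ M` is `m = ∑ₚ xₚ • ∑_g g • (yₚ • m)`, a
`B`-combination of the invariant elements `∑_g g • (yₚ • m)`: indeed
`∑ₚ ∑_g xₚ g(yₚ) • g(m) = ∑_g δ_{g,1} g(m) = m`. This is the surjectivity half of Greither, Ch. 0,
Thm. 7.1, made explicit by the dual basis of Thm. 1.6 (ii′).
[cite: Greither1992CyclicGalois, Ch. 0 Thm. 7.1 (pp. 28–29)] -/
theorem sum_smul_sum_smul_smul_eq_self (hs₁ : ∑ p ∈ s, p.1 * p.2 = 1)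
    (hs : ∀ g : G, g ≠ 1 → ∑ p ∈ s, p.1 * g • p.2 = 0) (m : M) :
    ∑ p ∈ s, p.1 • ∑ g : G, g • (p.2 • m) = m := by
  classical
  calc ∑ p ∈ s, p.1 • ∑ g : G, g • (p.2 • m)
      = ∑ g : G, (∑ p ∈ s, p.1 * g • p.2) • g • m := by
        simp_rw [Finset.smul_sum, smul_distrib_smul, smul_smul, Finset.sum_smul]
        exact Finset.sum_comm
    _ = m := by
        rw [Fintype.sum_eq_single (1 : G) (fun g hg ↦ by rw [hs g hg, zero_smul])]
        simp_rw [one_smul]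
        rw [hs₁, one_smul]

end Formula

/-! ### Theorem 7.1: `B ⊗_A M^G ≅ M` -/

section Descent

variable [SMulCommClass G A B] [Module A M] [IsScalarTower A B M] [SMulDistribClass G B M]
variable [Fintype G] [Algebra.IsInvariant A B G] [FaithfulSMul A B]

/-- **Galois descent of modules (Greither, Ch. 0, Thm. 7.1; Chase–Harrison–Rosenberg, Thm. 1.3).**
For a free action of the finite group `G` on `B` with `B^G = A ⊆ B` and a `B`-module `M` with a
descent datum (`g • (b • m) = (g • b) • (g • m)`), the inclusion of the invariants `N = M^G ↪ M` is
a base change along `A → B`: the canonical `B`-linear map `B ⊗_A M^G → M`, `b ⊗ n ↦ b • n`, is an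
isomorphism. Proof: surjective by the descent formula `sum_smul_sum_smul_smul_eq_self`; a left
inverse is `m ↦ ∑ₚ xₚ ⊗ ∑_g g • (yₚ • m)`, which sends `b • n` (`n` invariant) to
`∑ₚ xₚ ⊗ tr(yₚ b) • n = (∑ₚ tr(b yₚ) xₚ) ⊗ n = b ⊗ n` by the dual basis identity
`sum_sum_smul_mul_eq_self`. [cite: Greither1992CyclicGalois, Ch. 0 Thm. 7.1 (pp. 28–29)] -/
theorem isBaseChange_of_free
    (hfree : ∀ g : G, g ≠ 1 → Ideal.span (Set.range fun b : B ↦ g • b - b) = ⊤)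
    (N : Submodule A M) (hN : ∀ m : M, m ∈ N ↔ ∀ g : G, g • m = m) :
    IsBaseChange B N.subtype := by
  classical
  obtain ⟨s, hs₁, hs⟩ := exists_finset_sum_mul_smul_of_free A G hfree
  -- the canonical map `μ : B ⊗_A N → M`, `b ⊗ n ↦ b • n`
  let μ : B ⊗[A] N →ₗ[B] M :=
    TensorProduct.AlgebraTensorModule.lift (LinearMap.toSpanSingleton B (N →ₗ[A] M) N.subtype)
  have hμ : ∀ (b : B) (n : N), μ (b ⊗ₜ[A] n) = b • (n : M) := fun b n ↦ rfl
  -- the module traces `τ y : m ↦ ∑_g g • (y • m)`, valued in `N`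
  choose τ hτ using fun y : B ↦ exists_linearMap_coe_apply_eq A G N hN y
  -- the candidate inverse `ν : m ↦ ∑ₚ xₚ ⊗ τ_{yₚ} m`
  let ν : M →ₗ[A] B ⊗[A] N := ∑ p ∈ s, (TensorProduct.mk A B N p.1) ∘ₗ τ p.2
  have hν : ∀ m : M, ν m = ∑ p ∈ s, p.1 ⊗ₜ[A] τ p.2 m := fun m ↦ by
    simp only [ν, LinearMap.sum_apply, LinearMap.comp_apply, TensorProduct.mk_apply]
  -- `ν (b • n) = b ⊗ n` for `n ∈ N`
  have hνμ : ∀ (b : B) (n : N), ν (b • (n : M)) = b ⊗ₜ[A] n := by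
    intro b n
    have hn : ∀ g : G, g • (n : M) = n := (hN _).mp n.2
    have hτn : ∀ y : B, τ y (b • (n : M)) = trace A G (y * b) • n := fun y ↦ Subtype.ext <| by
      rw [hτ, Submodule.coe_smul, ← algebraMap_smul B (trace A G (y * b)) (n : M),
        algebraMap_trace]
      simp_rw [smul_smul]
      exact sum_smul_smul_eq_sum_smul_smul (y * b) hn
    rw [hν]
    simp_rw [hτn, ← TensorProduct.smul_tmul]
    rw [← TensorProduct.sum_tmul]
    congr 1
    simp_rw [trace_smul, mul_comm _ b]
    exact sum_sum_smul_mul_eq_self hs₁ hs b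
  -- `ν ∘ μ = id`, hence `μ` is injective
  have hleft : ∀ t : B ⊗[A] N, ν (μ t) = t := fun t ↦ by
    induction t using TensorProduct.induction_on with
    | zero => rw [map_zero, map_zero]
    | tmul b n => rw [hμ, hνμ]
    | add x y hx hy => rw [map_add, map_add, hx, hy]
  have hinj : Function.Injective μ := fun t t' h ↦ by rw [← hleft t, ← hleft t', h]
  -- `μ` is surjective by the descent formula
  have hsurj : Function.Surjective μ := fun m ↦ by
    refine ⟨∑ p ∈ s, p.1 ⊗ₜ[A] τ p.2 m, ?_⟩
    rw [map_sum]
    simp_rw [hμ, hτ]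
    exact sum_smul_sum_smul_smul_eq_self hs₁ hs m
  refine IsBaseChange.of_equiv (LinearEquiv.ofBijective μ ⟨hinj, hsurj⟩) fun n ↦ ?_
  change μ ((1 : B) ⊗ₜ[A] n) = (n : M)
  rw [hμ, one_smul]

/-! ### The trace takes the value `1`; `M^G` is a direct summand of `M`; finiteness descends -/

/-- **The trace of a Galois extension is onto** (Chase–Harrison–Rosenberg, Lemma 1.6; Greither,
Ch. 0, proof of Thm. 1.6): for a free action with `B^G = A ⊆ B` some `c ∈ B` has
`tr(c) = ∑_g g • c = 1`. Proof: `I = tr(B)` is an ideal of `A` with `I B = B` (dual basis identity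
`b = ∑ₚ tr(b yₚ) xₚ`), `B` is a finitely generated faithful `A`-module, so Nakayama gives `I = A`.
[cite: ChaseHarrisonRosenberg1965, Lemma 1.6] -/
theorem exists_trace_eq_one_of_free
    (hfree : ∀ g : G, g ≠ 1 → Ideal.span (Set.range fun b : B ↦ g • b - b) = ⊤) :
    ∃ c : B, trace A G c = 1 := by
  classical
  obtain ⟨s, hs₁, hs⟩ := exists_finset_sum_mul_smul_of_free A G hfree
  haveI : Module.Finite A B := finite_of_free A G hfree
  let I : Ideal A := LinearMap.range (trace A G : B →ₗ[A] A)
  have htop : (⊤ : Submodule A B) ≤ I • ⊤ := by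
    intro b _
    rw [← sum_sum_smul_mul_eq_self hs₁ hs b]
    refine Submodule.sum_mem _ fun p _ ↦ ?_
    rw [← trace_smul A G (b * p.2) p.1]
    exact Submodule.smul_mem_smul (LinearMap.mem_range_self _ _) Submodule.mem_top
  obtain ⟨r, hr, hr0⟩ :=
    Submodule.exists_sub_one_mem_and_smul_eq_zero_of_fg_of_le_smul I ⊤ Module.Finite.fg_top htop
  have hr' : r = 0 := by
    have h1 : r • (1 : B) = 0 := hr0 1 Submodule.mem_top
    rw [Algebra.smul_def, mul_one] at h1
    exact FaithfulSMul.algebraMap_injective A B (by rw [h1, map_zero])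
  rw [hr', zero_sub] at hr
  have h1 : (1 : A) ∈ I := by simpa using I.neg_mem hr
  obtain ⟨c, hc⟩ := LinearMap.mem_range.mp h1
  exact ⟨c, hc⟩

/-- **`M^G` is an `A`-direct summand of `M`**: with `tr(c) = 1` (`exists_trace_eq_one_of_free`),
the module trace `m ↦ ∑_g g • (c • m)` is an `A`-linear retraction `M → M^G` (on an invariant
`n`, `∑_g g • (c • n) = tr(c) • n = n`). Hence `M ↦ M^G` preserves every property of `A`-modules
stable under direct summands (Greither, Ch. 0 §7; Chase–Harrison–Rosenberg, Thm. 1.3 / Lemma 1.6).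
[cite: Greither1992CyclicGalois, Ch. 0 Thm. 7.1 (pp. 28–29)] -/
theorem exists_linearMap_apply_coe_eq_self_of_free
    (hfree : ∀ g : G, g ≠ 1 → Ideal.span (Set.range fun b : B ↦ g • b - b) = ⊤)
    (N : Submodule A M) (hN : ∀ m : M, m ∈ N ↔ ∀ g : G, g • m = m) :
    ∃ ρ : M →ₗ[A] N, ∀ n : N, ρ n = n := by
  obtain ⟨c, hc⟩ := exists_trace_eq_one_of_free A G hfree
  obtain ⟨ρ, hρ⟩ := exists_linearMap_coe_apply_eq A G N hN c
  refine ⟨ρ, fun n ↦ Subtype.ext ?_⟩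
  rw [hρ, sum_smul_smul_eq_sum_smul_smul c ((hN _).mp n.2), ← algebraMap_trace (A := A), hc,
    map_one, one_smul]

/-- **Finiteness descends**: if `M` is a finitely generated `B`-module with a descent datum, then
`M^G` is a finitely generated `A`-module (`B` is finite over `A` by `finite_of_free`, and `M^G` is a
quotient of `M` by the retraction of `exists_linearMap_apply_coe_eq_self_of_free`).
[cite: Greither1992CyclicGalois, Ch. 0 Thm. 7.1 (pp. 28–29)] -/
theorem finite_invariants_of_free [Module.Finite B M]
    (hfree : ∀ g : G, g ≠ 1 → Ideal.span (Set.range fun b : B ↦ g • b - b) = ⊤)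
    (N : Submodule A M) (hN : ∀ m : M, m ∈ N ↔ ∀ g : G, g • m = m) :
    Module.Finite A N := by
  haveI : Module.Finite A B := finite_of_free A G hfree
  haveI : Module.Finite A M := Module.Finite.trans B M
  obtain ⟨ρ, hρ⟩ := exists_linearMap_apply_coe_eq_self_of_free A G hfree N hN
  exact Module.Finite.of_surjective ρ fun n ↦ ⟨n, hρ n⟩

end Descent

/-! ### Proposition 7.2: descent of morphisms -/

section Equivariant

variable {G}
variable {M' : Type*} [AddCommGroup M'] [Module B M'] [DistribMulAction G M'] [Module A M']

omit [Algebra A B] [MulSemiringAction G B] in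
/-- A `G`-equivariant `B`-linear map sends invariants to invariants (Greither, Ch. 0, proof of
Prop. 7.2: "`g(A₁)` is fixed under all `Φ_σ^{(2)}`, hence contained in `A₂`").
[cite: Greither1992CyclicGalois, Ch. 0 Prop. 7.2 (p. 29)] -/
theorem map_mem_of_forall_map_smul (f : M →ₗ[B] M')
    (hf : ∀ (g : G) (m : M), f (g • m) = g • f m)
    (N' : Submodule A M') (hN' : ∀ m' : M', m' ∈ N' ↔ ∀ g : G, g • m' = m')
    {m : M} (hm : ∀ g : G, g • m = m) : f m ∈ N' :=
  (hN' _).mpr fun g ↦ by rw [← hf, hm g]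

end Equivariant

section Morphisms

variable [SMulCommClass G A B] [Module A M] [IsScalarTower A B M] [SMulDistribClass G B M]
variable [Fintype G] [Algebra.IsInvariant A B G] [FaithfulSMul A B]
variable {M' : Type*} [AddCommGroup M'] [Module B M']

/-- **Uniqueness of descended morphisms** (Greither, Ch. 0, Prop. 7.2, "`f` is unique if it
exists"): two `B`-linear maps out of `M` that agree on the invariants `M^G` are equal, because
`M = B • M^G` (`isBaseChange_of_free`). [cite: Greither1992CyclicGalois, Ch. 0 Prop. 7.2 (p. 29)] -/
theorem eq_of_forall_apply_coe_eq_of_free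
    (hfree : ∀ g : G, g ≠ 1 → Ideal.span (Set.range fun b : B ↦ g • b - b) = ⊤)
    (N : Submodule A M) (hN : ∀ m : M, m ∈ N ↔ ∀ g : G, g • m = m)
    (f₁ f₂ : M →ₗ[B] M') (h : ∀ n : N, f₁ n = f₂ n) : f₁ = f₂ :=
  (isBaseChange_of_free A G hfree N hN).algHom_ext f₁ f₂ h

variable [Module A M'] [IsScalarTower A B M']

/-- **Existence of the extension** (Greither, Ch. 0, Prop. 7.2): every `A`-linear map
`φ : M^G → N′` into an `A`-submodule `N′ ⊆ M′` extends uniquely to a `B`-linear map `F : M → M′`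
(`F = B ⊗ φ` under `B ⊗_A M^G ≅ M`). [cite: Greither1992CyclicGalois, Ch. 0 Prop. 7.2 (p. 29)] -/
theorem existsUnique_extend_of_free
    (hfree : ∀ g : G, g ≠ 1 → Ideal.span (Set.range fun b : B ↦ g • b - b) = ⊤)
    (N : Submodule A M) (hN : ∀ m : M, m ∈ N ↔ ∀ g : G, g • m = m)
    (N' : Submodule A M') (φ : N →ₗ[A] N') :
    ∃! F : M →ₗ[B] M', ∀ n : N, F n = φ n := by
  have h := isBaseChange_of_free A G hfree N hN
  refine ⟨h.lift (N'.subtype ∘ₗ φ), fun n ↦ h.lift_eq (N'.subtype ∘ₗ φ) n, fun F hF ↦ ?_⟩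
  exact h.algHom_ext F _ fun n ↦ by
    rw [Submodule.subtype_apply, hF n]; exact (h.lift_eq (N'.subtype ∘ₗ φ) n).symm

variable [DistribMulAction G M'] [SMulDistribClass G B M']

omit [IsScalarTower A B M'] in
/-- **The extension is `G`-equivariant** (Greither, Ch. 0, Prop. 7.2, the direction "`S ⊗ f`
commutes with the trivial descent data"): if `F : M → M′` is `B`-linear and maps `M^G` into
`M′^G`, then `F (g • m) = g • F m` for all `g`, `m` — check on `m = b • n` with `n` invariant,
where both sides are `(g • b) • F n`. [cite: Greither1992CyclicGalois, Ch. 0 Prop. 7.2 (p. 29)] -/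
theorem map_smul_of_forall_apply_coe_mem_of_free
    (hfree : ∀ g : G, g ≠ 1 → Ideal.span (Set.range fun b : B ↦ g • b - b) = ⊤)
    (N : Submodule A M) (hN : ∀ m : M, m ∈ N ↔ ∀ g : G, g • m = m)
    (N' : Submodule A M') (hN' : ∀ m' : M', m' ∈ N' ↔ ∀ g : G, g • m' = m')
    (F : M →ₗ[B] M') (hF : ∀ n : N, F n ∈ N') (g : G) (m : M) :
    F (g • m) = g • F m := by
  have h := isBaseChange_of_free A G hfree N hN
  induction m using h.inductionOn with
  | zero => rw [smul_zero, map_zero, smul_zero]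
  | tmul n => rw [Submodule.subtype_apply, (hN _).mp n.2 g, ((hN' _).mp (hF n)) g]
  | smul b m hm =>
    rw [smul_distrib_smul g b m, LinearMap.map_smul, LinearMap.map_smul, hm]
    exact (smul_distrib_smul g b (F m)).symm
  | add m₁ m₂ h₁ h₂ => rw [smul_add, map_add, map_add, smul_add, h₁, h₂]

end Morphisms

end Literature.RingTheory.GaloisAlgebras
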